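import Literature.Analysis.FluidPDE.NSLerayHopf
import HarnessLib

/-!
# Galdi's energy equality for `L⁴(Q_T)` distributional solutions — decomposition of
  `NS.galdi_energy_equality`

`Literature.Analysis.FluidPDE.NSLerayHopf` records, as the named fact `Literature.Analysis.FluidPDE.galdi_energy_equality`,
Theorem 1.1 of Galdi (2018): a distributional (pressure-free, divergence-free-tested) solution
`v` of the unforced Navier–Stokes Cauchy problem on `ℝ³ × (0, T)` with datum `v₀ ∈ L²_σ(ℝ³)`
which lies in `L⁴(0, T; L⁴(ℝ³))` "is in the class `L^∞(0, T; L²_σ) ∩ L²(0, T; H¹)` and thus obeys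
the energy equality" — no finite energy or dissipation being assumed a priori.

The printed statement has exactly two layers, and this file separates them:

* **the class assertion** (the content of Galdi's paper, §2: Lemma 2.1 — unique solvability in
  `W^{1,2} ⊂ C([0,T]; H¹)` of the linear problem `∂ₜw + ṽ_(η)·∇w = Δw − ∇p + f̃`, `div w = 0`,
  `w(0) = (v₀)_(η)` with the space–time mollified, time-reversed drift `ṽ_(η)`, the uniform energy
  bound (2.3), and `W^{1,4/3}` regularity for `v₀ = 0`; the density Lemma A.1 of
  `𝒟_T = {φ ∈ C₀^∞(ℝ³ × [0,T)) : div φ = 0}` in `W₀^{1,q}`; and the duality identity (2.12) with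
  the adjoint solution `Φ_η`, in which `η → 0` gives `∫₀ᵀ ((v − u), f) = 0` for every
  `f ∈ C₀^∞`, `u` being a weak-* limit of the mollified linear solutions in
  `L^∞(0,T; L²) ∩ L²(0,T; H¹)`), vendored here as the named fact `NS.galdi_lerayHopf_class`
  [Galdi 2018, Thm. 1.1, "v is in the class (1.2)"];
* **"and thus obeys the energy equality"** — J.-L. Lions' theorem (1960; Galdi's ref. [10]) that a
  weak solution in the energy class `L^∞(0,T; L²_σ) ∩ L²(0,T; W^{1,2}_{0,σ})` which moreover has
  `u u ∈ L²(0,T; L²)` — in particular (Sohr (1.4.6)) one in `L⁴(0,T; L⁴)` — satisfies, after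
  redefinition on a null set of times, the energy equality
  `½‖u(t)‖₂² + ν ∫₀ᵗ ‖∇u‖₂² = ½‖u₀‖₂² + ∫₀ᵗ [f, u]` for all `t` (Shinbrot 1974; printed with proof
  as Sohr 2001, Ch. V, Thm. 1.4.1, for an arbitrary domain `Ω ⊆ ℝⁿ`, `n = 2, 3`), vendored here for
  the unforced Cauchy problem on `ℝ³` as the named fact `NS.lions_energy_equality_L4`
  [Sohr 2001, Ch. V, Thm. 1.4.1 with (1.4.6)].

The assembly `NS.galdi_energy_equality_of` — the two named facts imply `galdi_energy_equality` —
is proved, as is the converse projection `NS.galdi_lerayHopf_class_of` (the class assertion is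
literally the first half of the vendored conclusion), so that discharging the two facts discharges
`galdi_energy_equality` with no loss.

## Contents

* `NS.galdi_lerayHopf_class` — Galdi 2018, Thm. 1.1, class assertion (named fact).
* `NS.lions_energy_equality_L4` — Sohr 2001, Ch. V, Thm. 1.4.1 + (1.4.6) on `ℝ³`, `f = 0`
  (Lions 1960; Shinbrot 1974) (named fact).
* `NS.galdi_energy_equality_of` — the assembly (real proof).
* `NS.galdi_lerayHopf_class_of` — `galdi_energy_equality → galdi_lerayHopf_class` (real proof).

## Design notes

* Both facts are stated in the conventions of `NS.galdi_energy_equality` and of the accepted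
  `Fluid.IsLerayHopfOn`: an honest field `u : ℝ → ℝ³ → ℝ³` seen through integrals, the class
  `L^∞(0,T; L²)` as the guarded mixed-norm predicate `Fluid.MemLqLp ∞ 2 u (Ioo 0 T)`, and
  `L²(0,T; H¹)` as a slice-wise weak gradient `G t` of `u t` for a.e. `t` with
  `∫₀ᵀ ∫ |G|² < ∞` as an iterated lower integral (field `weakGrad_energy` of `Fluid.IsLerayHopfOn`).
  Joint measurability of `G` on the strip is not demanded: a jointly strongly measurable version
  with the same slices a.e. always exists (accepted
  `Fluid.exists_stronglyMeasurable_of_sliced_weakGradient`, `FluidPDE/LerayHopfSpatialGradient`),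
  so this is Sohr's `∇u ∈ L²(0,T; L²(Ω)^{n²})` up to that proved selection.
* Sohr's weak solutions (Ch. V, Def. 1.1.1) are tested against `C₀^∞([0,T); C₀^∞_{0,σ}(Ω))`, with
  the datum entering through `⟨u₀, v(0)⟩` — for `Ω = ℝ³` this is the accepted
  `Fluid.IsWeakNSSolutionOn T ν 0 u₀ u` (tests smooth, compactly supported in `(-∞, T) × ℝ³`,
  divergence free at every time; the two test classes agree on `[0, T) × ℝ³` up to Seeley
  extension across `t = 0`, which acts in `t` only and so preserves `div_x = 0`), whose identity
  `∫∫ ⟪u, ∂ₜψ⟫ + ⟪u, (u·∇)ψ⟫ + ν⟪u, Δψ⟫ = -∫⟪u₀, ψ(0)⟫` is Sohr's (1.1.6) after one integration by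
  parts in `x` in the viscous and convective terms (legitimate in his class, Lemma V.1.2.1).
  `u₀ ∈ L²_σ(ℝ³)` is `MemLp u₀ 2 ∧ Fluid.IsWeaklyDivFree u₀` and `W^{1,2}_{0,σ}(ℝ³)` is
  `{v ∈ W^{1,2} : div v = 0}` (whole space: no normal trace; Sohr, Lemmas II.2.5.4–2.5.5 — the
  slices `u t` are weakly divergence free for a.e. `t` by `Fluid.IsWeakNSSolutionOn`). Sohr's class is local in time up to `T` (`L^∞_loc([0,T); L²_σ)` etc.) and
  his `T ≤ ∞`; the vendored hypotheses (global on `(0, T)`, `T < ∞`) are the stronger ones, and the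
  conclusion is the a.e.-`t` form of "for all `t ∈ [0,T)` after a redefinition on a null set"
  (for a.e. `t` the honest slice `u t` is a.e. the redefined one, by Fubini, so the kinetic terms
  agree; the dissipation integrals agree for every `t` by a.e. uniqueness of weak gradients).
  The equality is asserted for **the given** slice-wise gradient `G` (any two agree a.e. in
  space for a.e. time, accepted `HasWeakFDerivOn.unique`), which is what the assembly consumes.
* Both facts carry a general viscosity `ν > 0` (Sohr does; Galdi normalises `ν = 1`, footnote 1,
  and `v(x,t) := ν⁻¹ u(x, t/ν)` transports every class involved, as recorded in the docstring of
  `NS.galdi_energy_equality`).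

## References

* G. P. Galdi, *On the energy equality for distributional solutions to Navier–Stokes equations*,
  Proc. Amer. Math. Soc. 147 (2019) 785–792 (arXiv:1710.05725), Thm. 1.1, Lemma 2.1, (2.3),
  (2.10)–(2.15), Lemma A.1, Rem. 2.1.
* H. Sohr, *The Navier–Stokes equations. An elementary functional analytic approach*, Birkhäuser
  Advanced Texts (2001), Ch. V, §1.1, Def. 1.1.1 (weak solutions, test class
  `C₀^∞([0,T); C^∞_{0,σ}(Ω))`); §1.4, Thm. 1.4.1 with (1.4.2), (1.4.6), pp. 272–273 (index:
  "energy equality, 272"); Ch. II, Lemmas 2.5.4–2.5.5 (`L²_σ(ℝⁿ)`, `W^{1,2}_{0,σ}(ℝⁿ)`).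
* J.-L. Lions, *Sur la régularité et l'unicité des solutions turbulentes des équations de Navier
  Stokes*, Rend. Sem. Mat. Univ. Padova 30 (1960) 16–23 (Galdi's [10]).
* M. Shinbrot, *The energy equation for the Navier–Stokes system*, SIAM J. Math. Anal. 5 (1974)
  948–954 (Sohr's [Shi74]).
-/

noncomputable section

open MeasureTheory TopologicalSpace Set Function Filter Topology
open scoped InnerProductSpace RealInnerProductSpace ENNReal NNReal

namespace Literature.Analysis.FluidPDE

/-- Local notation for physical space `ℝ³ = EuclideanSpace ℝ (Fin 3)`. -/
local notation "ℝ³" => EuclideanSpace ℝ (Fin 3)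

/-! ### Layer 1a: the class assertion of Galdi's Theorem 1.1 -/

/-- **Galdi 2018, Thm. 1.1 — the class assertion.** Let `T > 0`, `ν > 0`, `u₀ ∈ L²_σ(ℝ³)`
(square integrable and weakly divergence free), and let `u` be a distributional (pressure-free,
divergence-free-tested) solution of the unforced Navier–Stokes system on `ℝ³ × (0, T)` with datum
`u₀` — Galdi's (1.5), the accepted `Fluid.IsWeakNSSolutionOn T ν 0 u₀ u`. If moreover
`u ∈ L⁴(0, T; L⁴(ℝ³))` (Galdi's (1.4)), then "`v` is in the class (1.2)", i.e.
`u ∈ L^∞(0, T; L²) ∩ L²(0, T; H¹)`: rendered, as in `NS.galdi_energy_equality` and the accepted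
`Fluid.IsLerayHopfOn`, as the guarded mixed-norm membership `Fluid.MemLqLp ∞ 2 u (Ioo 0 T)`
together with a slice-wise weak gradient `G t` of `u t` for a.e. `t ∈ (0, T)` with
`∫₀ᵀ ∫ |G|² < ∞` (iterated lower integral; a jointly measurable version exists by the accepted
`Fluid.exists_stronglyMeasurable_of_sliced_weakGradient`). No finite energy or dissipation is
assumed. This is the part of Theorem 1.1 proved in Galdi's §2 (Lemma 2.1, the duality identity
(2.12) and the limit `η → 0`, (2.13)–(2.15), with the density Lemma A.1); the energy equality
itself is then Lions' theorem (`NS.lions_energy_equality_L4`). Galdi takes `ν = 1` (footnote 1);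
`v(x, t) := ν⁻¹ u(x, t/ν)` reduces the general case to it. [cite: Galdi2018, Thm 1.1] -/
def galdi_lerayHopf_class : Prop :=
  ∀ {ν T : ℝ} (hν : 0 < ν) (hT : 0 < T) {u₀ : ℝ³ → ℝ³} {u : ℝ → ℝ³ → ℝ³} (hu₀ : MemLp u₀ 2 volume) (hdiv₀ : FluidPDE.IsWeaklyDivFree u₀) (hw : FluidPDE.IsWeakNSSolutionOn T ν 0 u₀ u) (h₄ : FluidPDE.MemLqLp 4 4 u (Ioo 0 T)),
    FluidPDE.MemLqLp ∞ 2 u (Ioo 0 T) ∧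
    ∃ G : ℝ → ℝ³ → ℝ³ →L[ℝ] ℝ³,
      (∀ᵐ t ∂(volume.restrict (Ioo 0 T)), FluidPDE.HasWeakGradient (u t) (G t)) ∧
      (∫⁻ t in Ioo 0 T, ∫⁻ x, ENNReal.ofReal (FluidPDE.frobeniusNormSq (G t x)) < ∞)

/-! ### Layer 1b: the energy equality in the class `L⁴(0, T; L⁴)` (Lions 1960; Sohr Thm. V.1.4.1) -/

/-- **The energy equality for weak solutions with `u u ∈ L²(0,T; L²)`** (Sohr 2001, Ch. V,
Thm. 1.4.1 with the sufficient condition (1.4.6) `u ∈ L⁴(0,T; L⁴)`; J.-L. Lions 1960;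
Shinbrot 1974), for the unforced Cauchy problem on `ℝ³`. Let `ν > 0`, `0 < T`,
`u₀ ∈ L²_σ(ℝ³)`, and let `u` be a weak solution with datum `u₀` in the energy class: a
distributional (pressure-free, divergence-free-tested) solution on `ℝ³ × (0, T)` (accepted
`Fluid.IsWeakNSSolutionOn T ν 0 u₀ u`, Sohr's Def. V.1.1.1 for `Ω = ℝ³`) with
`u ∈ L^∞(0, T; L²)` (`Fluid.MemLqLp ∞ 2`) and `∇u ∈ L²(0, T; L²)` through a slice-wise weak
gradient `G t` of `u t` for a.e. `t`, `∫₀ᵀ ∫ |G|² < ∞`. If moreover `u ∈ L⁴(0, T; L⁴(ℝ³))`, then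
the **energy equality** `½‖u(t)‖₂² + ν ∫₀ᵗ ‖∇u‖₂² = ½‖u₀‖₂²` holds — printed: for all
`t ∈ [0, T)` after a redefinition of `u` on a null set of times (along which `u` becomes strongly
`L²`-continuous); rendered, `u` being an honest function seen through integrals, for a.e.
`t ∈ (0, T)`, with the dissipation measured by the given `G` (weak gradients are a.e. unique,
accepted `HasWeakFDerivOn.unique`). Specialisation of the printed theorem (any domain
`Ω ⊆ ℝⁿ`, `n = 2, 3`, `T ≤ ∞`, force `f = f₀ + div F`, classes local in time up to `T`) to
`Ω = ℝ³`, `f = 0`, `T < ∞` and classes global on `(0, T)`. [cite: Sohr2001, Ch. V Thm. 1.4.1 with (1.4.6)] -/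
def lions_energy_equality_L4 : Prop :=
  ∀ {ν T : ℝ} (hν : 0 < ν) (hT : 0 < T) {u₀ : ℝ³ → ℝ³} {u : ℝ → ℝ³ → ℝ³} (hu₀ : MemLp u₀ 2 volume) (hdiv₀ : FluidPDE.IsWeaklyDivFree u₀) (hw : FluidPDE.IsWeakNSSolutionOn T ν 0 u₀ u) (h₂ : FluidPDE.MemLqLp ∞ 2 u (Ioo 0 T)) {G : ℝ → ℝ³ → ℝ³ →L[ℝ] ℝ³} (hG : ∀ᵐ t ∂(volume.restrict (Ioo 0 T)), FluidPDE.HasWeakGradient (u t) (G t)) (hG₂ : ∫⁻ t in Ioo 0 T, ∫⁻ x, ENNReal.ofReal (FluidPDE.frobeniusNormSq (G t x)) < ∞) (h₄ : FluidPDE.MemLqLp 4 4 u (Ioo 0 T)),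
    ∀ᵐ t ∂(volume.restrict (Ioo 0 T)), VectorCalculus.kineticEnergy (u t) +
      ν * (∫⁻ τ in Ioo 0 t, ∫⁻ x, ENNReal.ofReal (FluidPDE.frobeniusNormSq (G τ x))).toReal =
        VectorCalculus.kineticEnergy u₀

/-! ### The assembly -/

/-- **Galdi's Theorem 1.1 from its two layers** (Galdi 2018, Thm. 1.1: "`v` is in the class
(1.2) *and thus* obeys the energy equality", the second step being Lions' theorem [10]). The
class assertion `galdi_lerayHopf_class` supplies `u ∈ L^∞(0,T; L²)` and a square-integrable
slice-wise weak gradient `G`; the energy equality in `L⁴(0,T; L⁴)` (`lions_energy_equality_L4`)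
applied to this `G` gives the a.e.-`t` energy identity. Real proof. [cite: Galdi2018, Thm 1.1] -/
theorem galdi_energy_equality_of (h₁ : galdi_lerayHopf_class) (h₂ : lions_energy_equality_L4) :
    galdi_energy_equality := by
  intro ν T hν hT u₀ u hu₀ hdiv₀ hw h₄
  obtain ⟨hL, G, hG, hG₂⟩ := h₁ hν hT hu₀ hdiv₀ hw h₄
  exact ⟨hL, G, hG, hG₂, h₂ hν hT hu₀ hdiv₀ hw hL hG hG₂ h₄⟩

/-- Conversely, the class assertion is the first half of the vendored conclusion of
`NS.galdi_energy_equality` (projection; Galdi 2018, Thm. 1.1). Real proof. [cite: Galdi2018, Thm 1.1] -/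
theorem galdi_lerayHopf_class_of (h : galdi_energy_equality) : galdi_lerayHopf_class := by
  intro ν T hν hT u₀ u hu₀ hdiv₀ hw h₄
  obtain ⟨hL, G, hG, hG₂, -⟩ := h hν hT hu₀ hdiv₀ hw h₄
  exact ⟨hL, G, hG, hG₂⟩

end Literature.Analysis.FluidPDE
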